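import Mathlib
import HarnessLib

/-!
# Local layer propagation: extraction tools for the compactness step

Route `BrittleRungDescent`, support item `SoftLayerPropagation` (stmt-AtomisticToContinuum-9210),
helper file (general topology / bookkeeping only).

* `exists_quarter_net` — a finite `1/4`-net of the closed `R`-ball of `ℝ³`.
* `exists_enumeration` — the points of a `1/2`-separated configuration in the `R`-ball about `c`
  are enumerated injectively by the points of a fixed `1/4`-net (index type independent of the
  configuration), inactive indices carrying `0`.
* `exists_cluster` — for a sequence of uniformly bounded families `Y n : ι → ℝ³` with finite
  labels `τ n`, some label `t` and family `X` are approached simultaneously along a subsequence: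
  `∀ ε > 0, ∃ᶠ n, τ n = t ∧ ∀ i, dist (Y n i) (X i) < ε`.

All statements are elementary ([folklore]).
-/

noncomputable section

namespace Summit.AtomisticToContinuum.Crystallization.Theorems

open Filter Topology

/-- **A finite `1/4`-net of the closed `R`-ball.** [folklore] -/
theorem exists_quarter_net (R : ℝ) :
    ∃ t : Finset (EuclideanSpace ℝ (Fin 3)),
      Metric.closedBall (0 : EuclideanSpace ℝ (Fin 3)) R ⊆ ⋃ y ∈ t, Metric.ball y (1 / 4) := by
  obtain ⟨t, htfin, hcover⟩ := Metric.totallyBounded_iff.1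
    (isCompact_closedBall (0 : EuclideanSpace ℝ (Fin 3)) R).totallyBounded (1 / 4) (by norm_num)
  refine ⟨htfin.toFinset, ?_⟩
  intro x hx
  have := hcover hx
  simp only [Set.mem_iUnion] at this ⊢
  obtain ⟨y, hy, hxy⟩ := this
  exact ⟨y, htfin.mem_toFinset.2 hy, hxy⟩

/-- **Enumeration by a net.**  Let `S` be a configuration whose points within `R` of `c` are
`1/2`-separated from all other points of `S`, and `t` a `1/4`-net of the `R`-ball.  Then there are
`D : t → Bool` (active indices) and `Y : t → ℝ³` with: active `y` ↦ a point `c + Y y ∈ S` within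
`R` of `c`; every point of `S` within `R` of `c` is `c + Y y` for an active `y`; `Y` is injective on
active indices; inactive indices carry `0`. [folklore] -/
theorem exists_enumeration {S : Set (EuclideanSpace ℝ (Fin 3))} {c : EuclideanSpace ℝ (Fin 3)} {R : ℝ}
    (t : Finset (EuclideanSpace ℝ (Fin 3)))
    (ht : Metric.closedBall (0 : EuclideanSpace ℝ (Fin 3)) R ⊆ ⋃ y ∈ t, Metric.ball y (1 / 4))
    (hgap : ∀ v ∈ S, dist v c ≤ R → ∀ w ∈ S, w ≠ v → 1 / 2 ≤ dist v w) :
    ∃ (D : ↥t → Bool) (Y : ↥t → EuclideanSpace ℝ (Fin 3)),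
      (∀ y, D y = true → c + Y y ∈ S ∧ ‖Y y‖ ≤ R) ∧
      (∀ v ∈ S, dist v c ≤ R → ∃ y, D y = true ∧ c + Y y = v) ∧
      (∀ y y', D y = true → D y' = true → Y y = Y y' → y = y') ∧
      (∀ y, D y = false → Y y = 0) := by
  classical
  -- a net point for every point of `S` in the ball
  have hex : ∀ v : EuclideanSpace ℝ (Fin 3), v ∈ S ∧ dist v c ≤ R → ∃ y : ↥t, dist (v - c) y < 1 / 4 := by
    rintro v ⟨-, hv⟩
    have : v - c ∈ Metric.closedBall (0 : EuclideanSpace ℝ (Fin 3)) R := by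
      rwa [Metric.mem_closedBall, dist_zero_right, ← dist_eq_norm]
    have := ht this
    simp only [Set.mem_iUnion, Metric.mem_ball] at this
    obtain ⟨y, hy, hvy⟩ := this
    exact ⟨⟨y, hy⟩, hvy⟩
  set F : EuclideanSpace ℝ (Fin 3) → EuclideanSpace ℝ (Fin 3) := fun v =>
    if h : v ∈ S ∧ dist v c ≤ R then ((hex v h).choose : EuclideanSpace ℝ (Fin 3)) else 0 with hF
  have hF1 : ∀ v (h : v ∈ S ∧ dist v c ≤ R), F v ∈ t ∧ dist (v - c) (F v) < 1 / 4 := by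
    intro v h
    simp only [hF, dif_pos h]
    exact ⟨(hex v h).choose.2, (hex v h).choose_spec⟩
  -- `F` is injective on the points of `S` in the ball
  have hFinj : ∀ v w, v ∈ S ∧ dist v c ≤ R → w ∈ S ∧ dist w c ≤ R → F v = F w → v = w := by
    intro v w hv hw he
    by_contra hne
    have h1 := (hF1 v hv).2
    have h2 := (hF1 w hw).2
    rw [he] at h1
    have h3 : dist v w < 1 / 2 := by
      have := dist_triangle_right (v - c) (w - c) (F w)
      rw [dist_sub_right] at this
      linarith
    have := hgap v hv.1 hv.2 w hw.1 (Ne.symm hne)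
    linarith
  set P : ↥t → Prop := fun y => ∃ v, (v ∈ S ∧ dist v c ≤ R) ∧ F v = y.1 with hP
  refine ⟨fun y => decide (P y), fun y => if h : P y then h.choose - c else 0, ?_, ?_, ?_, ?_⟩
  · intro y hy
    have h : P y := of_decide_eq_true hy
    simp only [dif_pos h, add_sub_cancel]
    refine ⟨h.choose_spec.1.1, ?_⟩
    rw [← dist_eq_norm]; exact h.choose_spec.1.2
  · intro v hv hvc
    have hvin : v ∈ S ∧ dist v c ≤ R := ⟨hv, hvc⟩
    refine ⟨⟨F v, (hF1 v hvin).1⟩, ?_, ?_⟩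
    · exact decide_eq_true ⟨v, hvin, rfl⟩
    · have h : P ⟨F v, (hF1 v hvin).1⟩ := ⟨v, hvin, rfl⟩
      simp only [dif_pos h, add_sub_cancel]
      exact hFinj _ _ h.choose_spec.1 hvin h.choose_spec.2
  · intro y y' hy hy' he
    have h : P y := of_decide_eq_true hy
    have h' : P y' := of_decide_eq_true hy'
    simp only [dif_pos h, dif_pos h'] at he
    have hvv : h.choose = h'.choose := by
      have := congrArg (· + c) he
      simpa using this
    apply Subtype.ext
    rw [← h.choose_spec.2, ← h'.choose_spec.2, hvv]
  · intro y hy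
    have h : ¬P y := of_decide_eq_false hy
    simp only [dif_neg h]

/-- **Simultaneous cluster point of bounded families with finite labels.** [folklore] -/
theorem exists_cluster {ι T : Type*} [Fintype ι] [Finite T] (τ : ℕ → T)
    (Y : ℕ → ι → EuclideanSpace ℝ (Fin 3)) {R : ℝ} (hR : 0 ≤ R) (hY : ∀ n i, ‖Y n i‖ ≤ R) :
    ∃ (t : T) (X : ι → EuclideanSpace ℝ (Fin 3)),
      ∀ ε > 0, ∃ᶠ n in atTop, τ n = t ∧ ∀ i, dist (Y n i) (X i) < ε := by
  -- a label taken infinitely often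
  obtain ⟨t, hfreq⟩ : ∃ t, ∃ᶠ n in atTop, τ n = t := by
    by_contra h
    push Not at h
    have : ∀ᶠ n in atTop, ∀ t, τ n ≠ t := Filter.eventually_all.2 h
    obtain ⟨n, hn⟩ := this.exists
    exact hn (τ n) rfl
  obtain ⟨φ, hφ, hτφ⟩ := Filter.extraction_of_frequently_atTop hfreq
  -- Bolzano–Weierstrass in `ι → ℝ³`
  set Z : ℕ → (ι → EuclideanSpace ℝ (Fin 3)) := fun n => Y (φ n) with hZ
  have hZmem : ∀ n, Z n ∈ Metric.closedBall (0 : ι → EuclideanSpace ℝ (Fin 3)) R := by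
    intro n
    rw [Metric.mem_closedBall, dist_zero_right, pi_norm_le_iff_of_nonneg hR]
    exact fun i => hY _ i
  obtain ⟨X, -, ψ, hψ, hlim⟩ := (isCompact_closedBall (0 : ι → EuclideanSpace ℝ (Fin 3)) R).tendsto_subseq hZmem
  refine ⟨t, X, fun ε hε => ?_⟩
  rw [Filter.frequently_atTop]
  intro N
  have hev : ∀ᶠ m in atTop, dist ((Z ∘ ψ) m) X < ε := (Metric.tendsto_nhds.1 hlim) ε hε
  obtain ⟨m, hm, hmN⟩ := (hev.and (Filter.eventually_ge_atTop N)).exists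
  refine ⟨φ (ψ m), ?_, hτφ _, fun i => ?_⟩
  · exact hmN.trans ((hψ.id_le m).trans (hφ.id_le _))
  · exact lt_of_le_of_lt (dist_le_pi_dist (Z (ψ m)) X i) hm

end Summit.AtomisticToContinuum.Crystallization.Theorems
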